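import Mathlib
import Summits.Ventures.HodgeRepro.Tier4.Target
import Summits.Ventures.HodgeRepro.Tier4.Line3.KMDatum
import Summits.Ventures.HodgeRepro.Tier4.Line3.KMDatumS
import Summits.Ventures.HodgeRepro.Tier4.Line3.Defs

/-!
# Tier4/Line3/DefsLemmas — the sorry-free theorems of LINE L3's skeleton, verbatim

Blind re-derivation cell `pub-hodge-repro`, Tier 4 «PROVE THE STEP» (README §9–§10).  Line L3 (planner t4-plan-3):
`Tier4/Line3/Skeleton.lean` v0.14, sha256 5b774b9a8f48f824d10bb62c4e4e18383ea9412af18a51e163cf606befcaa3f5, 1004 lines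
(«LINE L3 FILED» S12401).  Companion of `Tier4/Line3/Defs.lean` (the definitions; filer t4-L3-p2): the 11 sorry-free
theorems of the skeleton that consume no `sorry` — `summable`, `tail_tendsto`, `pairing_eq`, `P`, `exists_pairingZ_ne_zero`, `conclusion_of_pairingZ_ne_zero`, `exists_of_pairing_ne_zero`, `hform_smul`, `hform_unitary`, `gramStep_of_orbitStep`, `gaussDef_pos` — statements and proofs
BYTE-IDENTICAL, in the same order, namespaces and section variables.  The only additions are the one-line docstrings the
gate's docstring lint requires on `summable`, `tail_tendsto`, `pairing_eq`, `gaussDef_pos` (none in the skeleton).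

Nothing here says anything about the status of the Hodge conjecture for CM abelian varieties, which is NOT proved
(HC_CM is NOT proved by anyone in this repository).
-/
set_option autoImplicit false

noncomputable section

namespace Summit.Ventures.HodgeRepro.Tier4.Line3

open Summit.Ventures.HodgeRepro.Tier4
open Matrix MeasureTheory NumberField
open Filter Topology
open scoped ComplexConjugate ComplexOrder

open scoped Classical

section Assembly

variable {Level : Type} {Tr : Level → Type}

namespace OrbitExpansion

variable {Orbit : Type} {pairing : ∀ K : Level, Tr K → ℂ} {term : ∀ K : Level, Tr K → Orbit → ℂ}

/-- Absolute convergence gives convergence of the orbit expansion. -/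
theorem summable (E : OrbitExpansion Orbit pairing term) (K : Level) (γ : Tr K) : Summable (term K γ) :=
  (E.summable_norm K γ).of_norm

namespace Localizer

variable {E : OrbitExpansion Orbit pairing term} (L : E.Localizer)

/-- The tail off the main orbit tends to `0` (dominated convergence, Tannery). -/
theorem tail_tendsto : Tendsto L.tail atTop (𝓝 0) := by
  have h : Tendsto (fun N => ∑' o, if o = L.main then (0 : ℂ) else term (L.level N) (L.loc N) o) atTop
      (𝓝 (∑' o : Orbit, (0 : ℂ))) := by
    refine tendsto_tsum_of_dominated_convergence L.bound_summable (fun o => ?_)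
      (Eventually.of_forall fun N o => ?_)
    · by_cases ho : o = L.main
      · simp [ho]
      · simp only [ho, if_false]
        exact L.tendsto_zero o ho
    · by_cases ho : o = L.main
      · simp only [ho, if_true, norm_zero]
        exact L.bound_nonneg L.main
      · simp only [ho, if_false]
        exact L.norm_term_le N o ho
  rw [tsum_zero] at h
  exact h

/-- The pairing at depth `N` is the main term plus the tail. -/
theorem pairing_eq (N : ℕ) : pairing (L.level N) (L.loc N) = term (L.level N) (L.loc N) L.main + L.tail N := by
  rw [E.expansion (L.level N) (L.loc N), tail]
  exact (E.summable (L.level N) (L.loc N)).tsum_eq_add_tsum_ite L.main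

/-- **THE CONCLUSION OF THE ASSEMBLY**: a localiser gives a level and a translate with non-zero pairing. -/
theorem P (L : E.Localizer) : ∃ (K : Level) (γ : Tr K), pairing K γ ≠ 0 := by
  obtain ⟨m, hm, hev⟩ := L.main_lower
  have htail : ∀ᶠ N in atTop, ‖L.tail N‖ < m := by
    have := (L.tail_tendsto).norm
    simp only [norm_zero] at this
    exact this.eventually (gt_mem_nhds hm)
  obtain ⟨N, hN1, hN2⟩ := (hev.and htail).exists
  refine ⟨L.level N, L.loc N, fun h0 => ?_⟩
  have h := L.pairing_eq N
  rw [h0] at h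
  have : term (L.level N) (L.loc N) L.main = -L.tail N := by linear_combination -h
  rw [this, norm_neg] at hN1
  exact absurd (lt_of_lt_of_le hN2 hN1) (lt_irrefl _)

end Localizer

end OrbitExpansion

end Assembly

namespace T4Data

variable (X : T4Data)

/-- A formal combination with non-zero pairing has a Hecke quadruple with non-zero pairing (finite-sum logic). -/
theorem exists_pairingZ_ne_zero {K : X.Level} {γ : X.Tr K} (hne : X.pairing K γ ≠ 0) :
    ∃ h : X.TrZ K, X.pairingZ K h ≠ 0 := by
  by_contra hall
  apply hne
  have hall' : ∀ h : X.TrZ K, X.pairingZ K h = 0 := fun h =>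
    by_contra fun hh => hall ⟨h, hh⟩
  unfold pairing
  calc (Finsupp.sum γ fun h c => c * X.pairingZ K h)
      = Finsupp.sum γ fun _ _ => (0 : ℂ) := by
        refine Finsupp.sum_congr fun h _ => ?_
        rw [hall' h, mul_zero]
    _ = 0 := Finsupp.sum_fun_zero γ

/-- If the pairing of `P_T4` at some level and some Hecke quadruple is not zero, the chosen domain is a fundamental
domain (else the integral would be over `∅`) — the existential of `P_T4` for the objects of `X`. -/
theorem conclusion_of_pairingZ_ne_zero {K : X.Level} {h : X.TrZ K} (hne : X.pairingZ K h ≠ 0) :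
    ∃ (Γ' : Set (Matrix (Fin 3) (Fin 3) X.E)),
      IsCongruenceSubgroup X.c X.H Γ' ∧ Γ' ⊆ X.Γ ∧
    ∃ (h : Fin 4 → HeckeElement X.E), (∀ i, (h i).IsFor X.c X.H Γ') ∧
    ∃ (D : Set (Fin 2 → ℂ)), IsFundamentalDomainFor (ballActions X.τ₀ X.C Γ') D ∧
      ∫ z in D, X.integrand h z ≠ 0 := by
  refine ⟨K.1, K.2.1, K.2.2, h.1, h.2, X.domain K, ?_, hne⟩
  unfold domain
  split_ifs with hD
  · exact (Classical.choose_spec hD).1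
  · exfalso
    apply hne
    unfold pairingZ domain
    rw [dif_neg hD]
    simp

/-- The bridge assembled: a level and a formal combination with non-zero pairing give the existential of `P_T4`. -/
theorem exists_of_pairing_ne_zero {K : X.Level} {γ : X.Tr K} (hne : X.pairing K γ ≠ 0) :
    ∃ (Γ' : Set (Matrix (Fin 3) (Fin 3) X.E)),
      IsCongruenceSubgroup X.c X.H Γ' ∧ Γ' ⊆ X.Γ ∧
    ∃ (h : Fin 4 → HeckeElement X.E), (∀ i, (h i).IsFor X.c X.H Γ') ∧
    ∃ (D : Set (Fin 2 → ℂ)), IsFundamentalDomainFor (ballActions X.τ₀ X.C Γ') D ∧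
      ∫ z in D, X.integrand h z ≠ 0 := by
  obtain ⟨h, hh⟩ := X.exists_pairingZ_ne_zero hne
  exact X.conclusion_of_pairingZ_ne_zero hh

/-- `hform` is sesquilinear for scalars: `⟨a x, b y⟩ = c(a) b ⟨x, y⟩`. -/
theorem hform_smul (a b : X.E) (x y : Fin 3 → X.E) :
    hform X.c X.H (a • x) (b • y) = X.c a * b * hform X.c X.H x y := by
  unfold hform
  have h1 : (fun i => X.c ((a • x) i)) = X.c a • fun i => X.c (x i) := by
    funext i
    simp [map_mul]
  rw [h1, Matrix.mulVec_smul, smul_dotProduct, dotProduct_smul, smul_eq_mul, smul_eq_mul]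
  ring

/-- L3.a: `hform` is invariant under `U(H)`. -/
theorem hform_unitary {g : Matrix (Fin 3) (Fin 3) X.E} (hg : IsUnitaryOf X.c X.H g) (x y : Fin 3 → X.E) :
    hform X.c X.H (g *ᵥ x) (g *ᵥ y) = hform X.c X.H x y := by
  unfold hform
  have hc : (fun i => X.c ((g *ᵥ x) i)) = (g.map X.c) *ᵥ (fun i => X.c (x i)) := by
    funext i
    simp [Matrix.mulVec, dotProduct, map_sum, map_mul, Matrix.map_apply]
  rw [hc, ← Matrix.vecMul_transpose, ← dotProduct_mulVec, Matrix.mulVec_mulVec, Matrix.mulVec_mulVec]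
  unfold IsUnitaryOf cstar at hg
  rw [hg]

/-- The Gram class is an invariant of the orbit. -/
theorem gramStep_of_orbitStep {x x' : X.Tuple} (h : X.orbitStep x x') : X.gramStep (X.gram x) (X.gram x') := by
  obtain ⟨g, hg, t, ht, hx⟩ := h
  refine ⟨t, ht, fun i j => ?_⟩
  simp only [gram, hx]
  rw [X.hform_smul, X.hform_unitary hg]

end T4Data

namespace T4Data

variable (X : T4Data)

/-- The Gaussian of the definite places is positive. -/
theorem gaussDef_pos (x : Fin 3 → X.E) : 0 < X.gaussDef x := by
  unfold gaussDef
  refine finprod_induction (fun r : ℝ => 0 < r) one_pos (fun _ _ ha hb => mul_pos ha hb) fun σ => ?_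
  exact finprod_induction (fun r : ℝ => 0 < r) one_pos (fun _ _ ha hb => mul_pos ha hb) fun _ => Real.exp_pos _

end T4Data

end Summit.Ventures.HodgeRepro.Tier4.Line3

end
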